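import Mathlib
import Summits.AtomisticToContinuum.Crystallization.Theorems.ChargedEnergyGap.Negative.Unconditional
import Summits.AtomisticToContinuum.Crystallization.Theorems.ChessboardParticlePlanesLjLaminarWindowsGlueLevels
import Summits.AtomisticToContinuum.Crystallization.Theorems.ChessboardParticlePlanesLjLaminarWindowsMinDistance
import Summits.AtomisticToContinuum.Crystallization.Theorems.ChessboardParticlePlanesLjLaminarWindowsEarnshaw
import Summits.AtomisticToContinuum.Crystallization.Theorems.ChessboardParticlePlanesLjLaminarWindowsGlueC5
import Literature.MathematicalPhysics.StatisticalMechanics.LennardJonesClusters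
import HarnessLib

/-!
# Glue of the NSF branch of line `Sketch` (crux `LjLaminarWindows`, stmt-AtomisticToContinuum-6711), lead c8

Registered stub `stub_glueNSF`: a.e. laminarity (14293) + the non-spiky-fraction statement (NSF) +
window removal + shell bound + path count ⇒ the crux.  At every large radius `L`, eventually in `N`,
at least `δ N` particles are non-spiky (shell count `≤ θ ·` ball count) while fewer than `δ N` are
non-laminar, so (pigeonhole) some particle is laminar AND non-spiky; its window holds `≥ k₀`
particles (path count), and window removal plus the shell bound (`C · #shell ≤ C θ #ball ≤ (ε/4) #ball`)
give its energy clause, `laminar_of_levels` the isometry — the bookkeeping of `stub_glueC5`.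
-/

noncomputable section

open scoped BigOperators
open Filter Topology
open Literature.MathematicalPhysics.StatisticalMechanics
open Summit.AtomisticToContinuum.Crystallization.Theorems.ChargedEnergyGapNegative

namespace Summit.AtomisticToContinuum.Crystallization.Theorems.LjLaminarWindowsSketch

/-- **Glue of the NSF branch (registered stub `stub_glueNSF` of line `Sketch`).** A.e. laminarity +
non-spiky fraction + window removal + shell bound + path count ⇒ the crux `LjLaminarWindows`
(statement unfolded): for every sequence of Lennard-Jones ground states and every `η, ε > 0` there
is `L₀` such that for every `L ≥ L₀`, frequently in `N`, some particle-centred closed `L`-ball is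
`7/10`-separated, `η`-laminar and has internal energy `≤ 2(e* + ε)` per particle.  Constants:
`k₀ = k₀(ε/4)` (window removal), `(R, C) = hSB(ε/4)`, `θ = min (ε/(4C)) (1/2)`,
`L₀ = max (max L₀^{NSF}(θ,R) 1) (23 k₀/20)`. [folklore] -/
theorem stub_glueNSF
    (hLam : ∀ t R : ℝ, 0 < t → 0 < R → ∀ x : (N : ℕ) → (Fin N → EuclideanSpace ℝ (Fin 3)),
      (∀ N, IsGroundState lennardJones (x N)) →
      Filter.Tendsto (fun N : ℕ => (Nat.card {i : Fin N // ¬ (∃ n : EuclideanSpace ℝ (Fin 3),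
        ‖n‖ = 1 ∧ ∃ c : ℤ → ℝ, (∀ k : ℤ, c k + 3 / 4 ≤ c (k + 1)) ∧ ∀ j : Fin N,
          dist (x N j) (x N i) ≤ R → ∃ k : ℤ, |inner ℝ (x N j - x N i) n - c k| ≤ t)} : ℝ) / N)
        Filter.atTop (nhds 0))
    (hNSF : ∀ θ R : ℝ, 0 < θ → θ < 1 → 1 ≤ R → ∃ L₀ : ℝ, ∀ L : ℝ, L₀ ≤ L → ∃ δ : ℝ, 0 < δ ∧ ∃ N₀ : ℕ,
      ∀ N : ℕ, N₀ ≤ N → ∀ x : Fin N → E3,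
      (∀ j k : Fin N, j ≠ k → (7 : ℝ) / 10 ≤ dist (x j) (x k)) →
      (∀ S : Finset (Fin N), S.Nonempty → Sᶜ.Nonempty →
          ∃ p ∈ S, ∃ k ∈ Sᶜ, dist (x p) (x k) ≤ 23 / 20) →
      δ * (N : ℝ) ≤ ((Finset.univ.filter fun i : Fin N =>
        ((Finset.univ.filter fun q : Fin N =>
            L - R < dist (x q) (x i) ∧ dist (x q) (x i) ≤ L).card : ℝ) ≤
          θ * ((Finset.univ.filter fun q : Fin N => dist (x q) (x i) ≤ L).card : ℝ)).card : ℝ))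
    (hWR : ∀ η : ℝ, 0 < η → ∃ k₀ : ℕ, ∀ (N : ℕ) (x : Fin N → E3), IsGroundState lennardJones x →
      ∀ S : Finset (Fin N), k₀ ≤ S.card →
        ∑ i ∈ S, ∑ k ∈ S, lennardJones (dist (x i) (x k)) +
            2 * ∑ i ∈ S, ∑ k ∈ Sᶜ, lennardJones (dist (x i) (x k)) ≤
          2 * (eStar + η) * S.card)
    (hSB : ∀ ε : ℝ, 0 < ε → ∃ R C : ℝ, 1 ≤ R ∧ 0 < C ∧ ∀ (N : ℕ) (x : Fin N → E3),
      (∀ j k : Fin N, j ≠ k → (7 : ℝ) / 10 ≤ dist (x j) (x k)) → ∀ (i : Fin N) (L : ℝ),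
        ∑ j ∈ Finset.univ.filter (fun j : Fin N => dist (x j) (x i) ≤ L),
            ∑ k ∈ Finset.univ.filter (fun k : Fin N => ¬ dist (x k) (x i) ≤ L),
              max (-lennardJones (dist (x j) (x k))) 0 ≤
          ε * ((Finset.univ.filter fun j : Fin N => dist (x j) (x i) ≤ L).card : ℝ) +
            C * ((Finset.univ.filter fun j : Fin N =>
              L - R < dist (x j) (x i) ∧ dist (x j) (x i) ≤ L).card : ℝ))
    (hPC : ∀ (N : ℕ) (x : Fin N → E3) (ρ : ℝ), 0 < ρ →
      (∀ S : Finset (Fin N), S.Nonempty → Sᶜ.Nonempty → ∃ p ∈ S, ∃ k ∈ Sᶜ, dist (x p) (x k) ≤ ρ) →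
      ∀ (i : Fin N) (L : ℝ), 0 ≤ L → (∃ j : Fin N, L < dist (x j) (x i)) →
        L / ρ ≤ ((Finset.univ.filter fun j : Fin N => dist (x j) (x i) ≤ L).card : ℝ)) :
    ∀ x : (N : ℕ) → (Fin N → EuclideanSpace ℝ (Fin 3)), (∀ N, IsGroundState lennardJones (x N)) →
      ∀ η ε : ℝ, 0 < η → 0 < ε → ∃ L₀ : ℝ, ∀ L : ℝ, L₀ ≤ L → ∃ᶠ N in Filter.atTop,
        ∃ (i : Fin N) (A : EuclideanSpace ℝ (Fin 3) →ₗᵢ[ℝ] EuclideanSpace ℝ (Fin 3)) (T : Set ℝ),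
          (∀ t ∈ T, ∀ t' ∈ T, t ≠ t' → (3 : ℝ) / 4 ≤ |t - t'|) ∧
          (∀ j k : Fin N, j ≠ k → dist (x N j) (x N i) ≤ L → dist (x N k) (x N i) ≤ L →
            (7 : ℝ) / 10 ≤ dist (x N j) (x N k)) ∧
          (∀ j : Fin N, dist (x N j) (x N i) ≤ L → ∃ t ∈ T, |(A (x N j - x N i)) 2 - t| ≤ η) ∧
          (∑ j : Fin N, ∑ k : Fin N, if j ≠ k ∧ dist (x N j) (x N i) ≤ L ∧ dist (x N k) (x N i) ≤ L
              then lennardJones (dist (x N j) (x N k)) else 0) ≤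
            2 * ((⨅ Q : PeriodicConfiguration 3, Q.energyPerParticle lennardJones) + ε) *
              (Nat.card {j : Fin N // dist (x N j) (x N i) ≤ L} : ℝ) := by
  intro x hx η ε hη hε
  classical
  -- ground-state facts used throughout
  have hsep : ∀ (N : ℕ) (j k : Fin N), j ≠ k → (7 : ℝ) / 10 ≤ dist (x N j) (x N k) :=
    fun N j k hjk => lennardJones_groundState_dist_ge_seven_tenths (hx N) hjk
  have hconn : ∀ (N : ℕ) (S : Finset (Fin N)), S.Nonempty → Sᶜ.Nonempty →
      ∃ p ∈ S, ∃ k ∈ Sᶜ, dist (x N p) (x N k) ≤ 23 / 20 := fun N => glueC5_connected (hx N)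
  -- constants
  obtain ⟨k₀, hk₀⟩ := hWR (ε / 4) (by positivity)
  obtain ⟨R, C, hR1, hC, hSB'⟩ := hSB (ε / 4) (by positivity)
  obtain ⟨θ, hθ, hθ1, hCθ⟩ : ∃ θ : ℝ, 0 < θ ∧ θ < 1 ∧ C * θ ≤ ε / 4 := by
    refine ⟨min (ε / (4 * C)) (1 / 2), lt_min (by positivity) (by norm_num),
      lt_of_le_of_lt (min_le_right _ _) (by norm_num), ?_⟩
    calc C * min (ε / (4 * C)) (1 / 2) ≤ C * (ε / (4 * C)) :=
          mul_le_mul_of_nonneg_left (min_le_left _ _) hC.le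
      _ = ε / 4 := by field_simp
  obtain ⟨L₀', hNSF'⟩ := hNSF θ R hθ hθ1 hR1
  refine ⟨max (max L₀' 1) (23 / 20 * k₀), fun L hL => ?_⟩
  have hL1 : 1 ≤ L := le_trans (le_trans (le_max_right _ _) (le_max_left _ _)) hL
  have hLpos : 0 < L := by linarith
  have hLk : 23 / 20 * (k₀ : ℝ) ≤ L := le_trans (le_max_right _ _) hL
  have hL₀' : L₀' ≤ L := le_trans (le_trans (le_max_left _ _) (le_max_left _ _)) hL
  -- NSF at radius `L`
  obtain ⟨δ, hδ, N₀, hN₀⟩ := hNSF' L hL₀'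
  -- eventual bounds in `N` (hence frequently)
  have hE1 := (hLam η L hη hLpos x hx).eventually (gt_mem_nhds hδ)
  have hE2 : ∀ᶠ N : ℕ in atTop, k₀ ≤ N := eventually_ge_atTop k₀
  have hE3 : ∀ᶠ N : ℕ in atTop, 1 ≤ N := eventually_ge_atTop 1
  have hE4 : ∀ᶠ N : ℕ in atTop, N₀ ≤ N := eventually_ge_atTop N₀
  refine (hE1.and (hE2.and (hE3.and hE4))).frequently.mono ?_
  rintro N ⟨h1, h2, h3, h4⟩
  have hxN := hx N
  have hNpos : (0 : ℝ) < N := by exact_mod_cast h3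
  -- the laminarity predicate at radius `L`, thickness `η`
  let lam : Fin N → Prop := fun i => ∃ n : EuclideanSpace ℝ (Fin 3), ‖n‖ = 1 ∧
    ∃ c : ℤ → ℝ, (∀ k : ℤ, c k + 3 / 4 ≤ c (k + 1)) ∧ ∀ j : Fin N,
      dist (x N j) (x N i) ≤ L → ∃ k : ℤ, |inner ℝ (x N j - x N i) n - c k| ≤ η
  -- ball counts and shell counts
  let w : Fin N → ℝ := fun i => ((Finset.univ.filter fun j : Fin N => dist (x N j) (x N i) ≤ L).card : ℝ)
  let s : Fin N → ℝ := fun i => ((Finset.univ.filter fun j : Fin N =>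
    L - R < dist (x N j) (x N i) ∧ dist (x N j) (x N i) ≤ L).card : ℝ)
  -- pigeonhole: a non-spiky laminar particle
  obtain ⟨i, hsi, hlami⟩ : ∃ i, s i ≤ θ * w i ∧ lam i := by
    by_contra hcon
    push Not at hcon
    have hsub : (Finset.univ.filter fun i : Fin N => s i ≤ θ * w i) ⊆
        Finset.univ.filter fun i => ¬ lam i := by
      intro i hi
      simp only [Finset.mem_filter, Finset.mem_univ, true_and] at hi ⊢
      exact hcon i hi
    have hle : ((Finset.univ.filter fun i : Fin N => s i ≤ θ * w i).card : ℝ) ≤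
        ((Finset.univ.filter fun i => ¬ lam i).card : ℝ) := by
      exact_mod_cast Finset.card_le_card hsub
    have hnsf : δ * (N : ℝ) ≤ ((Finset.univ.filter fun i : Fin N => s i ≤ θ * w i).card : ℝ) :=
      hN₀ N h4 (x N) (hsep N) (hconn N)
    have hlt : ((Finset.univ.filter fun i => ¬ lam i).card : ℝ) < δ * (N : ℝ) := by
      have h1' := h1
      rw [glue_natCard_filter, div_lt_iff₀ hNpos] at h1'
      exact h1'
    linarith
  -- the window of `i`
  set B : Finset (Fin N) := Finset.univ.filter fun j : Fin N => dist (x N j) (x N i) ≤ L with hB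
  have hBcard : (B.card : ℝ) = w i := rfl
  -- (a) laminarity ⇒ isometry and height set
  obtain ⟨n, hn, c, hc, hwin⟩ := hlami
  obtain ⟨A, T, hT, hlamin⟩ := laminar_of_levels (x N) i L η n hn c hc hwin
  -- (b) the window holds at least `k₀` particles
  have hBk : k₀ ≤ B.card := by
    by_cases hfar : ∃ j : Fin N, L < dist (x N j) (x N i)
    · have hpc := hPC N (x N) (23 / 20) (by norm_num) (hconn N) i L hLpos.le hfar
      have h' : (k₀ : ℝ) ≤ L / (23 / 20) := by
        rw [le_div_iff₀ (by norm_num : (0 : ℝ) < 23 / 20)]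
        linarith
      exact_mod_cast h'.trans hpc
    · push Not at hfar
      have hBu : B = Finset.univ := by
        ext j
        simp only [hB, Finset.mem_filter, Finset.mem_univ, true_and, iff_true]
        exact hfar j
      rw [hBu, Finset.card_univ, Fintype.card_fin]
      exact h2
  -- (c) window removal and the shell bound
  have hrem := hk₀ N (x N) hxN B hBk
  have hcross := hSB' N (x N) (hsep N) i L
  have hBc : Bᶜ = Finset.univ.filter fun k : Fin N => ¬ dist (x N k) (x N i) ≤ L := by
    rw [hB, Finset.compl_filter]
  have hneg : -(∑ j ∈ B, ∑ k ∈ Bᶜ, lennardJones (dist (x N j) (x N k))) ≤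
      ∑ j ∈ B, ∑ k ∈ Finset.univ.filter (fun k : Fin N => ¬ dist (x N k) (x N i) ≤ L),
        max (-lennardJones (dist (x N j) (x N k))) 0 := by
    rw [hBc, ← Finset.sum_neg_distrib]
    refine Finset.sum_le_sum fun j _ => ?_
    rw [← Finset.sum_neg_distrib]
    exact Finset.sum_le_sum fun k _ => le_max_left _ _
  have hw0 : 0 ≤ w i := Nat.cast_nonneg _
  have hshell : C * s i ≤ ε / 4 * w i := by
    have h1 : C * s i ≤ C * (θ * w i) := mul_le_mul_of_nonneg_left hsi hC.le
    have h2 : C * θ * w i ≤ ε / 4 * w i := mul_le_mul_of_nonneg_right hCθ hw0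
    rw [← mul_assoc] at h1
    exact h1.trans h2
  have henergy : ∑ j ∈ B, ∑ k ∈ B, lennardJones (dist (x N j) (x N k)) ≤
      2 * (eStar + ε) * (B.card : ℝ) := by
    have hcross' : ∑ j ∈ B, ∑ k ∈ Finset.univ.filter (fun k : Fin N => ¬ dist (x N k) (x N i) ≤ L),
        max (-lennardJones (dist (x N j) (x N k))) 0 ≤ ε / 4 * w i + C * s i := hcross
    rw [hBcard]
    nlinarith [hrem, hneg, hcross', hshell, hw0, hε]
  -- (d) assemble
  refine ⟨i, A, T, hT, fun j k hjk _ _ => hsep N j k hjk, hlamin, ?_⟩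
  rw [← glueC5_window_sum_eq (x N) i L, glue_natCard_filter]
  exact henergy

end Summit.AtomisticToContinuum.Crystallization.Theorems.LjLaminarWindowsSketch

end
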